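import Summits.QuantumFields.YangMills.Theorems.BalabanUVNodesN09AtRecord13SepCoPHOnDomains
import Summits.QuantumFields.YangMills.Theorems.BalabanUVNodesPortZDStepRowsOn
import Literature.MathematicalPhysics.QuantumFieldTheory.Balaban1983to89.Node00.Record13Ax

/-!
# NODE O port, row PT-A-2 S5-0 (i) — [Balaban1987RG1] (1.19) p. 263 ∕ (2.16) p. 269 «the expressions in (2.1) are invariant with respect to gauge transformations of
# the field V» AT THE RE-CENTRED RECORD, ON THE SMALL-FIELD DOMAINS: the effective actions `A_k` and the merged term `𝓝_{k+1}` over the β-layer transport `TβOfRecord₁₃`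
# and the BLOCK-AXIAL-CENTRED cut-off `chiβOfRecord₁₃Ax` are gauge invariant on the domains — with the χ-invariance row (M1-dom) a THEOREM ([Ax-2]
# `chiFixed29Ax_gaugeAct_liftTransf`), not a hypothesis (contrast dag-n09-w4's `…N09AtRecord13SepCoPHOnDomains` §3–§4 at the choice-centred record, where it is
# the located clause `hχinv` ∕ [B11] (181)-covariance `hcov`)

CITATION HEADER.  [I] = [Balaban1987RG1]: p. 263 («the action A_k(U) defined on the space U_k(ε₀) … is gauge invariant»), (1.19) p. 263, (2.16) p. 269, (2.9) p. 266, (0.13) p. 254,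
(0.19)–(0.21) p. 255–256, (1.2) p. 260; [B11] = [Balaban1985Variational] Thm 1 p. 279.  Porter PT-A-2 (`ymgap-nodeO-port-PTA-2`), `--supports stmt-QuantumFields-27930 --as
helper`.  REUSED BY NAME: dag-n09-w4's engine `…BalabanUVNodes.N09AtRecord13SepCoPHOnDomains.invOn_effActionHT_of_stepsOn_on` and step supplier
`stepOn_TβOfRecord₁₃_of_subset_regSet_inter_of_on`, dag-n09-a's `isOpen_domAltOfRecord ∕ domAltOfRecord_gaugeAct_mem(_iff)`, PTZ-1's `PortZD.mergedTermT_gaugeAct_on`, [Ax-2]'s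
`chiFixed29Ax_gaugeAct_liftTransf`.

WHAT IS PROVED (0 sorry, 0 def).
* §1 `chiβOfRecord₁₃Ax_gaugeAct_liftTransf_of_mem_domAlt` — (M1-dom) AT THE RE-CENTRED RECORD IS A THEOREM: `χ^{Ax}_j(U^{v∘blockOf}) = χ^{Ax}_j(U)` at EVERY `U` whose average
  lies in the small-field domain of level `j+1`, from [B11] Thm 1's existence∕uniqueness binder on that domain at the cut-off's radius `ν.εreg` (no covariance clause);
  `…_ae_on` the a.e. form the engine reads.
* §2 `invOn_effActionHT_recordAx_of_stepsOn` — every `A_k`, `k ≤ n ≤ K`, over `TβOfRecord₁₃` and `chiβOfRecord₁₃Ax θ₀` is gauge invariant ON `D k` (`D 0 := univ`,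
  `D (i+1) := regSetOfRecord K i ρ_i ∩ domAltOfRecord θ₀.ν K (i+1)`), from the [B11] binder (levels `< n`), (F7a-dom) and (I19) — dag-n09-w4's member-side hypotheses MINUS `hχinv`.
* §3 `mergedTermT_gaugeAct_on_recordAx` — `𝓝_{k+1}(W^v) = 𝓝_{k+1}(W)` for `W ∈ regSetOfRecord K k ρ_k ∩ domAltOfRecord θ₀.ν K (k+1)`, adding the nesting
  «`Ū^k U_{k+1}(W) ∈ D k`» and [B11] at level `k+1` (radius `ε`) for `W`, `W^v` (PTZ-1's on-domain row fed by §2).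
HONEST FRAMING.  Bookkeeping over displayed N09-shape rows ((F7a-dom), (I19), nesting, [B11] binders); nothing of Bałaban's estimates asserted, ported or discharged; 27930
signed-open (⁸-Ax-LR4), no claim held; finite 𝕋⁴ at fixed ε — NOT continuum∕OS∕Clay; the Yang–Mills mass gap is NOT proved by any of this.
-/

noncomputable section

namespace Summit.QuantumFields.YangMills.Theorems.BalabanUVNodesPortS1

open MeasureTheory
open Literature.MathematicalPhysics.QuantumFieldTheory.Balaban1983to89
open Literature.MathematicalPhysics.QuantumFieldTheory.Balaban1983to89.Node00
open T4Continuum (T4Family)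
open B12Eq019ActionBody (integrand)
open B12RTGaugeInvariance254 (liftTransf)
open GaugeField (gaugeAct)
open B12ContinuousTransportInvarianceOn (isOpen_domAltOfRecord domAltOfRecord_gaugeAct_mem)
open Summit.QuantumFields.YangMills.BalabanUVNodes.N09AtRecord13SepCoPHOnDomains (invOn_effActionHT_of_stepsOn_on stepOn_TβOfRecord₁₃_of_subset_regSet_inter_of_on
  domAltOfRecord_gaugeAct_mem_iff integrand_comp_liftAct_ae_eq_on_of_invOn)
open B16Sect1Backgrounds (iter_gaugeAct gaugeAct_gaugeAct)
open Literature.MathematicalPhysics.QuantumFieldTheory.Balaban1983to89.Node00.ZeroInput (stepOutT mergedTermT_eq_stepOut)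

variable {F : T4Family} {N : ℕ} [NeZero N]

/-! ## §1 (M1-dom) at the re-centred record is a theorem -/

/-- **(M1-dom) AT THE RE-CENTRED RECORD**: `χ^{Ax}_j(U^{v∘blockOf}) = χ^{Ax}_j(U)` for every level-`j` field `U` whose average lies in the small-field domain of level `j+1`,
given [B11] Thm 1's existence and uniqueness on that (gauge-stable) domain at the cut-off's radius `ν.εreg` — [Ax-2]'s hypothesis-free (M1) fed by the binder at `Ū` and
at `Ū^v`. [cite: Balaban1987RG1, (2.9) p.266, (2.16) p.269; Balaban1985Variational, Thm 1 p.279] -/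
theorem chiβOfRecord₁₃Ax_gaugeAct_liftTransf_of_mem_domAlt (θ₀ : Stage13Params F N) (K : ℕ) (g : ℕ → ℝ) {j : ℕ} (hj : j + 1 ≤ (F.P K).m + (F.P K).K)
    (h11 : ∀ W ∈ domAltOfRecord F N θ₀.ν K (j + 1), UkExists F N K (j + 1) θ₀.ν.εreg W ∧ UniqueUkOrbit F N K (j + 1) θ₀.ν.εreg W)
    (v : GaugeTransf (F.P K) (j + 1) (SU N)) (U : GaugeField (F.P K) j (SU N)) (hU : (avOfRecord F N K j).avg U ∈ domAltOfRecord F N θ₀.ν K (j + 1)) :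
    chiβOfRecord₁₃Ax F N θ₀ K g j (gaugeAct (liftTransf v) U) = chiβOfRecord₁₃Ax F N θ₀ K g j U :=
  chiFixed29Ax_gaugeAct_liftTransf θ₀.ε₂₉ hj g v U (h11 _ hU).1 (h11 _ (domAltOfRecord_gaugeAct_mem θ₀.ν K (j + 1) v _ hU)).2

/-- The a.e. form over the fibres of the domain, every level `j < n ≤ K` (the engine's `hχ` row). [cite: Balaban1987RG1, (2.9) p.266, (2.16) p.269; Balaban1985Variational, Thm 1 p.279] -/
theorem chiβOfRecord₁₃Ax_gaugeAct_liftTransf_ae_on (θ₀ : Stage13Params F N) (K : ℕ) (g : ℕ → ℝ) {n : ℕ} (hn : n ≤ K)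
    (h11 : ∀ j < n, ∀ W ∈ domAltOfRecord F N θ₀.ν K (j + 1), UkExists F N K (j + 1) θ₀.ν.εreg W ∧ UniqueUkOrbit F N K (j + 1) θ₀.ν.εreg W) :
    ∀ j < n, ∀ v : GaugeTransf (F.P K) (j + 1) (SU N), ∀ᵐ U ∂(fieldMeasure (F.P K) j (SU N)),
      (avOfRecord F N K j).avg U ∈ domAltOfRecord F N θ₀.ν K (j + 1) →
        chiβOfRecord₁₃Ax F N θ₀ K g j (gaugeAct (liftTransf v) U) = chiβOfRecord₁₃Ax F N θ₀ K g j U := by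
  intro j hj v
  have hj' : j + 1 ≤ (F.P K).m + (F.P K).K := by simp only [T4Continuum.T4Family.P_K]; omega
  exact Filter.Eventually.of_forall fun U hU => chiβOfRecord₁₃Ax_gaugeAct_liftTransf_of_mem_domAlt θ₀ K g hj' (h11 j hj) v U hU

/-! ## §2 The effective actions over `TβOfRecord₁₃` and the re-centred cut-off are gauge invariant on the domains -/

/-- **`A_k(V^v) = A_k(V)` ON THE DOMAINS AT THE RE-CENTRED RECORD**, every `k ≤ n ≤ K`, with bookkeeping sets `D 0 := univ`, `D (i+1) := regSetOfRecord K i ρ_i ∩ domAltOfRecord θ₀.ν K (i+1)`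
(`ρ_i` the (0.19) density met at step `i`): from [B11] Thm 1 on the domains at radius `ν.εreg` (levels `< n`), (F7a-dom) «`χ^{Ax}_{i+1}` vanishes off `D (i+1)` over the fibres of
`domAlt (i+2)`» and (I19) integrability — dag-n09-w4's engine with its `hχ` row DISCHARGED by §1 and its per-step row by `stepOn_TβOfRecord₁₃_of_subset_regSet_inter_of_on`.
[cite: Balaban1987RG1, p.263, (0.13) p.254, (0.19) p.255, (2.9) p.266, (2.16) p.269; Balaban1985Variational, Thm 1 p.279] -/
theorem invOn_effActionHT_recordAx_of_stepsOn (θ₀ : Stage13Params F N) (K : ℕ) (g : ℕ → ℝ) {n : ℕ} (hn : n ≤ K)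
    (h11 : ∀ j < n, ∀ W ∈ domAltOfRecord F N θ₀.ν K (j + 1), UkExists F N K (j + 1) θ₀.ν.εreg W ∧ UniqueUkOrbit F N K (j + 1) θ₀.ν.εreg W)
    (hχreg : ∀ i, i + 1 < n → ∀ᵐ U ∂(fieldMeasure (F.P K) (i + 1) (SU N)),
      (avOfRecord F N K (i + 1)).avg U ∈ domAltOfRecord F N θ₀.ν K (i + 2) →
        U ∉ regSetOfRecord F N K i (betaInputOfRecord F N (TβOfRecord₁₃ F N) (chiβOfRecord₁₃Ax F N θ₀) K g i) ∩ domAltOfRecord F N θ₀.ν K (i + 1) →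
          chiβOfRecord₁₃Ax F N θ₀ K g (i + 1) U = 0)
    (hint : ∀ j < n, Integrable (betaInputOfRecord F N (TβOfRecord₁₃ F N) (chiβOfRecord₁₃Ax F N θ₀) K g j) (fieldMeasure (F.P K) j (SU N))) :
    ∀ k ≤ n, ∀ (v : GaugeTransf (F.P K) k (SU N)) (V : GaugeField (F.P K) k (SU N)),
      V ∈ Nat.rec (motive := fun j => Set (GaugeField (F.P K) j (SU N))) Set.univ
          (fun i _ => regSetOfRecord F N K i (betaInputOfRecord F N (TβOfRecord₁₃ F N) (chiβOfRecord₁₃Ax F N θ₀) K g i) ∩ domAltOfRecord F N θ₀.ν K (i + 1)) k →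
        effActionHT F N (TβOfRecord₁₃ F N) (chiβOfRecord₁₃Ax F N θ₀) K g k (gaugeAct v V) = effActionHT F N (TβOfRecord₁₃ F N) (chiβOfRecord₁₃Ax F N θ₀) K g k V := by
  have hn' : n ≤ (F.P K).m + (F.P K).K := hn.trans (by simp only [T4Continuum.T4Family.P_K]; omega)
  refine invOn_effActionHT_of_stepsOn_on (TβOfRecord₁₃ F N) (chiβOfRecord₁₃Ax F N θ₀) K g hn' (fun j => domAltOfRecord F N θ₀.ν K j) _
    (chiβOfRecord₁₃Ax_gaugeAct_liftTransf_ae_on θ₀ K g hn h11) ?_ ?_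
  · intro j hj
    cases j with
    | zero => exact Filter.Eventually.of_forall fun U _ hU => absurd (Set.mem_univ U) hU
    | succ i => exact hχreg i hj
  · intro j hj hlift
    exact stepOn_TβOfRecord₁₃_of_subset_regSet_inter_of_on F N (lt_of_lt_of_le hj hn) _ (hint j hj) (isOpen_domAltOfRecord θ₀.ν K (j + 1))
      (fun v V => domAltOfRecord_gaugeAct_mem_iff θ₀.ν K (j + 1) v V) subset_rfl hlift

/-! ## §3 The merged term at the re-centred record is gauge invariant on the domain -/

/-- **A LEVEL-k FUNCTIONAL INVARIANT ON `D` READS THE SAME VALUE AT `Ū^k U_{k+1}(W^v)` AND `Ū^k U_{k+1}(W)`** as soon as the latter lies in `D` — PTZ-1's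
`PortZD.apply_iter_Uk_gaugeAct_on` WITHOUT the gauge-stability of `D`: the residual transformation of [B11] (181) and the block lift compose to ONE fine transformation
(`gaugeAct_gaugeAct`), whose restriction acts at the single point `Ū^k U_{k+1}(W) ∈ D` (`iter_gaugeAct`). [cite: Balaban1987RG1, (0.21) p.256, (1.2) p.260, (2.16) p.269; Balaban1985Variational, (181) p.307] -/
theorem apply_iter_Uk_gaugeAct_on_of_mem {K k : ℕ} (hk : k + 1 ≤ (F.P K).m + (F.P K).K) {ε : ℝ} {A : Density (F.P K) k (SU N)}
    {D : Set (GaugeField (F.P K) k (SU N))} (hAon : ∀ (w : GaugeTransf (F.P K) k (SU N)) (U : GaugeField (F.P K) k (SU N)), U ∈ D → A (gaugeAct w U) = A U)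
    (v : GaugeTransf (F.P K) (k + 1) (SU N)) {W : GaugeField (F.P K) (k + 1) (SU N)}
    (hnest : Averaging.iter (avOfRecord F N K) k (Uk F N K (k + 1) ε W) ∈ D) (hW : UkExists F N K (k + 1) ε W) (hu : UniqueUkOrbit F N K (k + 1) ε (gaugeAct v W)) :
    A (Averaging.iter (avOfRecord F N K) k (Uk F N K (k + 1) ε (gaugeAct v W))) = A (Averaging.iter (avOfRecord F N K) k (Uk F N K (k + 1) ε W)) := by
  obtain ⟨u, -, hEq⟩ := PortZD.orbitRel_Uk_gaugeAct_blockLift hk v hW hu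
  rw [hEq, gaugeAct_gaugeAct, iter_gaugeAct (avOfRecord F N K) _ _ k (Nat.le_of_succ_le hk), hAon _ _ hnest]

variable (F N) in
/-- **`𝓝_{k+1}(W^v) = 𝓝_{k+1}(W)` FOR `W ∈ D'`** (any transport `T`, cut-off `χ`): from the image row on `D'`, `A_k` invariant ON `D` (no stability of `D` needed), the nesting
`Ū^k U_{k+1}(W) ∈ D` and [B11] at `W`, `W^v` — PTZ-1's `PortZD.mergedTermT_gaugeAct_on` with `hDst` removed. [cite: Balaban1987RG1, (1.6) p.261, p.263, (2.16) p.269] -/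
theorem mergedTermT_gaugeAct_on_of_mem (T : Transport F N) (χ : (K : ℕ) → (ℕ → ℝ) → (k : ℕ) → Density (F.P K) k (SU N)) (ε : ℝ) {K : ℕ} (g : ℕ → ℝ)
    {k : ℕ} (hk : k + 1 ≤ (F.P K).m + (F.P K).K) {D : Set (GaugeField (F.P K) k (SU N))} {D' : Set (GaugeField (F.P K) (k + 1) (SU N))}
    (hTon : ∀ (v : GaugeTransf (F.P K) (k + 1) (SU N)) (V : GaugeField (F.P K) (k + 1) (SU N)), V ∈ D' →
      T K k (integrand (χ K g k) (gfOfRecord F N K k) (g k) (effActionHT F N T χ K g k)) (gaugeAct v V) =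
        T K k (integrand (χ K g k) (gfOfRecord F N K k) (g k) (effActionHT F N T χ K g k)) V)
    (hAon : ∀ (w : GaugeTransf (F.P K) k (SU N)) (U : GaugeField (F.P K) k (SU N)), U ∈ D →
      effActionHT F N T χ K g k (gaugeAct w U) = effActionHT F N T χ K g k U)
    (v : GaugeTransf (F.P K) (k + 1) (SU N)) {W : GaugeField (F.P K) (k + 1) (SU N)} (hWD : W ∈ D')
    (hnest : Averaging.iter (avOfRecord F N K) k (Uk F N K (k + 1) ε W) ∈ D) (hW : UkExists F N K (k + 1) ε W) (hu : UniqueUkOrbit F N K (k + 1) ε (gaugeAct v W)) :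
    mergedTermT F N T χ ε K g k (gaugeAct v W) = mergedTermT F N T χ ε K g k W := by
  rw [mergedTermT_eq_stepOut, mergedTermT_eq_stepOut, stepOutT, stepOutT, PortZD.nextAction_gaugeAct_on hTon v hWD,
    apply_iter_Uk_gaugeAct_on_of_mem hk hAon v hnest hW hu]

/-- **`𝓝_{k+1}(W^v) = 𝓝_{k+1}(W)` AT THE RE-CENTRED RECORD ON THE DOMAIN** (`k + 1 ≤ K`): for `W ∈ regSetOfRecord K k ρ_k ∩ domAltOfRecord θ₀.ν K (k+1)`, given §2's rows at levels
`≤ k`, the NESTING «`Ū^k U_{k+1}(W) ∈ D k`» and [B11] Thm 1 for `W`, `W^v` at the minimiser's radius `ε` — the `A_k`-row and the image row DISCHARGED by §2 ∕ the step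
supplier. [cite: Balaban1987RG1, (1.6) p.261, (1.19) p.263, (2.16) p.269, (1.2) p.260; Balaban1985Variational, Thm 1 p.279] -/
theorem mergedTermT_gaugeAct_on_recordAx (θ₀ : Stage13Params F N) (ε : ℝ) (K : ℕ) (g : ℕ → ℝ) {k : ℕ} (hk : k + 1 ≤ K)
    (h11 : ∀ j < k + 1, ∀ W ∈ domAltOfRecord F N θ₀.ν K (j + 1), UkExists F N K (j + 1) θ₀.ν.εreg W ∧ UniqueUkOrbit F N K (j + 1) θ₀.ν.εreg W)
    (hχreg : ∀ i, i + 1 < k + 1 → ∀ᵐ U ∂(fieldMeasure (F.P K) (i + 1) (SU N)),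
      (avOfRecord F N K (i + 1)).avg U ∈ domAltOfRecord F N θ₀.ν K (i + 2) →
        U ∉ regSetOfRecord F N K i (betaInputOfRecord F N (TβOfRecord₁₃ F N) (chiβOfRecord₁₃Ax F N θ₀) K g i) ∩ domAltOfRecord F N θ₀.ν K (i + 1) →
          chiβOfRecord₁₃Ax F N θ₀ K g (i + 1) U = 0)
    (hint : ∀ j < k + 1, Integrable (betaInputOfRecord F N (TβOfRecord₁₃ F N) (chiβOfRecord₁₃Ax F N θ₀) K g j) (fieldMeasure (F.P K) j (SU N)))
    (v : GaugeTransf (F.P K) (k + 1) (SU N)) {W : GaugeField (F.P K) (k + 1) (SU N)}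
    (hWD : W ∈ regSetOfRecord F N K k (betaInputOfRecord F N (TβOfRecord₁₃ F N) (chiβOfRecord₁₃Ax F N θ₀) K g k) ∩ domAltOfRecord F N θ₀.ν K (k + 1))
    (hnest : Averaging.iter (avOfRecord F N K) k (Uk F N K (k + 1) ε W) ∈
      Nat.rec (motive := fun j => Set (GaugeField (F.P K) j (SU N))) Set.univ
        (fun i _ => regSetOfRecord F N K i (betaInputOfRecord F N (TβOfRecord₁₃ F N) (chiβOfRecord₁₃Ax F N θ₀) K g i) ∩ domAltOfRecord F N θ₀.ν K (i + 1)) k)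
    (hW : UkExists F N K (k + 1) ε W) (hu : UniqueUkOrbit F N K (k + 1) ε (gaugeAct v W)) :
    mergedTermT F N (TβOfRecord₁₃ F N) (chiβOfRecord₁₃Ax F N θ₀) ε K g k (gaugeAct v W) =
      mergedTermT F N (TβOfRecord₁₃ F N) (chiβOfRecord₁₃Ax F N θ₀) ε K g k W := by
  have hk' : k + 1 ≤ (F.P K).m + (F.P K).K := hk.trans (by simp only [T4Continuum.T4Family.P_K]; omega)
  have hA := invOn_effActionHT_recordAx_of_stepsOn θ₀ K g hk h11 hχreg hint
  -- the level-`k` density is lift-invariant a.e. over the fibres of the domain, hence its image is invariant on `D (k+1)`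
  have hρ : ∀ v' : GaugeTransf (F.P K) (k + 1) (SU N), ∀ᵐ U ∂(fieldMeasure (F.P K) k (SU N)),
      (avOfRecord F N K k).avg U ∈ domAltOfRecord F N θ₀.ν K (k + 1) →
        betaInputOfRecord F N (TβOfRecord₁₃ F N) (chiβOfRecord₁₃Ax F N θ₀) K g k (gaugeAct (liftTransf v') U) =
          betaInputOfRecord F N (TβOfRecord₁₃ F N) (chiβOfRecord₁₃Ax F N θ₀) K g k U := fun v' =>
    integrand_comp_liftAct_ae_eq_on_of_invOn
      (chiβOfRecord₁₃Ax_gaugeAct_liftTransf_ae_on θ₀ K g hk h11 k (Nat.lt_succ_self k))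
      (B12EffectiveActionInvarianceT.gfOfRecord_liftInvariant F N K hk')
      (by
        cases k with
        | zero => exact Filter.Eventually.of_forall fun U _ hU => absurd (Set.mem_univ U) hU
        | succ i => exact hχreg i (by omega))
      (fun w U hU => hA k (Nat.le_succ k) (liftTransf w) U hU) (g k) v'
  have hTon := stepOn_TβOfRecord₁₃_of_subset_regSet_inter_of_on F N hk _ (hint k (Nat.lt_succ_self k)) (isOpen_domAltOfRecord θ₀.ν K (k + 1))
    (fun v V => domAltOfRecord_gaugeAct_mem_iff θ₀.ν K (k + 1) v V) subset_rfl hρ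
  exact mergedTermT_gaugeAct_on_of_mem F N (TβOfRecord₁₃ F N) (chiβOfRecord₁₃Ax F N θ₀) ε g hk' hTon (fun w U hU => hA k (Nat.le_succ k) w U hU) v hWD hnest hW hu

end Summit.QuantumFields.YangMills.Theorems.BalabanUVNodesPortS1

end
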